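import Summits.QuantumFields.BalabanUV.Beta.JetCoefficientCauchy

/-!
# Beta / PolyRegularRestrict — narrowing the polystrip: `PolyHol`, `PolyRegular`, `StripRegularC`, `MatPolyHol` restrict to
# smaller half-widths, and the TWO-WIDTH consumer forms (structure certified at the zero-free half-width `a`, bound certified
# on a narrower strip `κ ≤ a`) (β sub-cell, CAP lane «KERNEL ALGEBRA + EXPORT», lineage `b2b-balaban-beta-cap3`, gen 8;
# companion of `Beta/PolyRegularAlgebra` and `Beta/JetCoefficientCauchy`)

The (S4) rows are consumed at SEVERAL half-widths: the structure ((Z1): `det K̂ ≠ 0`, hence holomorphy) is certified once on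
the polystrip of half-width `a = 9/10` (CAP-KERNEL §7), while the tail budget may prefer a narrower `κ′ = 3/5` where the sup
`M(κ′)` is far smaller (CAP-KERNEL §4.14 (d); `CapLatticeBudget` §3, the `N = 16` row).  What that needs from the kernel is the
trivial RESTRICTION lemmas missing so far — `polyHol_of_le`, `polyRegular_of_le`/`_mono`, `stripRegularC_of_le`/`_mono`,
`matPolyHol_of_le` (§1; function-style names, the structures living in other namespaces) — and the two-width versions of the
binder-shaped theorems (§2): `stripRegularC_of_polyHol_of_le`
(structure at `a`, ANY certified bound on `Strip κ`, `κ ≤ a` ⇒ `StripRegularC G κ M`), `stripRegularC_oneLoopForm₂` (the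
one-loop form `tr(A⁻¹B) − tr(A⁻¹ C A′⁻¹ D)` with `MatPolyHol` data and `det ≠ 0` at width `a`, bound at width `κ`) and
`stripRegularC_jet_of_bound₂` (the jet functional of `JetCoefficientCauchy`, structure at `a`, Cauchy data at `κ`).

HONEST FRAMING.  Bookkeeping lemmas; no number of the β-function, no binder INSTANCE for the cell's integrand, no certificate.
Discharging `BetaPertH` would make Bałaban's ultraviolet stability unconditional — NOT the continuum limit and NOT the Clay
problem.  [folklore] throughout; 0 `sorry`, 0 cite tags.
-/

namespace Summit.QuantumFields.BalabanUV.Beta.PolyRegularRestrict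

open Complex Set Metric
open Literature.MathematicalPhysics.QuantumFieldTheory.Balaban1983to89
open B4Strip (ofRealVec Strip)
open B4ContourShift
open Beta.AliasingTailL1
open Summit.QuantumFields.BalabanUV.Beta.PolyRegularAlgebra
open Summit.QuantumFields.BalabanUV.Beta.JetCoefficientCauchy
open scoped Real

noncomputable section

variable {d : ℕ}

/-! ## §1 Restriction to narrower half-widths, and weakening the bound -/

/-- polystrips are monotone in the half-widths. [folklore] -/
theorem polyStrip_mono {n : ℕ} {w w' : Fin n → ℝ} (h : ∀ j, w' j ≤ w j) : PolyStrip w' ⊆ PolyStrip w :=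
  fun _ hp μ => ⟨(hp μ).1, (hp μ).2.trans (h μ)⟩

/-- a narrower strip lies in the wider one. [folklore] -/
theorem strip_mono (n : ℕ) {κ κ' : ℝ} (h : κ' ≤ κ) : Strip n κ' ⊆ Strip n κ :=
  fun _ hp μ => ⟨(hp μ).1, (hp μ).2.trans h⟩

/-- open rectangles are monotone in the half-width. [folklore] -/
theorem openRect_mono {κ κ' : ℝ} (h : κ' ≤ κ) : openRect κ' ⊆ openRect κ :=
  fun _ hz => ⟨hz.1, ⟨by linarith [hz.2.1], by linarith [hz.2.2]⟩⟩

section Scalar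

variable {G : (Fin (d + 1) → ℂ) → ℂ} {w w' : Fin (d + 1) → ℝ}

/-- `PolyHol` restricts to smaller half-widths. [folklore] -/
theorem polyHol_of_le (h : PolyHol G w) (hw : ∀ j, w' j ≤ w j) : PolyHol G w' where
  cont := h.cont.mono (polyStrip_mono hw)
  diff := fun i q hq => (h.diff i q (polyStrip_mono (fun _ => hw _) hq)).mono (openRect_mono (hw i))
  sides := fun i q hq y hy => h.sides i q (polyStrip_mono (fun _ => hw _) hq) y (hy.trans (hw i))

/-- `PolyRegular` restricts to smaller half-widths (same bound). [folklore] -/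
theorem polyRegular_of_le {M : ℝ} (h : PolyRegular G w M) (hw : ∀ j, w' j ≤ w j) : PolyRegular G w' M :=
  (polyHol_of_le (polyHol_of_polyRegular h) hw).regular fun p hp => h.bound p (polyStrip_mono hw hp)

/-- `PolyRegular` with a weaker bound. [folklore] -/
theorem polyRegular_mono {M M' : ℝ} (h : PolyRegular G w M) (hM : M ≤ M') : PolyRegular G w M' :=
  ⟨h.cont, h.diff, h.sides, fun p hp => (h.bound p hp).trans hM⟩

/-- `StripRegularC` restricts to a narrower strip (same bound). [folklore] -/
theorem stripRegularC_of_le {κ κ' M : ℝ} (h : StripRegularC G κ M) (hκ : κ' ≤ κ) : StripRegularC G κ' M :=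
  polyRegular_of_le h fun _ => hκ

/-- `StripRegularC` with a weaker bound. [folklore] -/
theorem stripRegularC_mono {κ M M' : ℝ} (h : StripRegularC G κ M) (hM : M ≤ M') : StripRegularC G κ M' :=
  polyRegular_mono h hM

/-- THE TWO-WIDTH BINDER: structure (`PolyHol`) at half-width `a`, ANY certified bound `M` on the narrower `Strip κ`, `κ ≤ a`
⇒ `StripRegularC G κ M`. [folklore] -/
theorem stripRegularC_of_polyHol_of_le {a κ M : ℝ} (h : PolyHol G (fun _ => a)) (hκ : κ ≤ a)
    (hM : ∀ p ∈ Strip (d + 1) κ, ‖G p‖ ≤ M) : StripRegularC G κ M :=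
  (polyHol_of_le h fun _ => hκ).stripRegularC hM

/-- and a better bound on a narrower strip improves an existing binder: `StripRegularC G a M` + `‖G‖ ≤ M′` on `Strip κ`,
`κ ≤ a` ⇒ `StripRegularC G κ M′`. [folklore] -/
theorem stripRegularC_rebound {a κ M M' : ℝ} (h : StripRegularC G a M) (hκ : κ ≤ a)
    (hM : ∀ p ∈ Strip (d + 1) κ, ‖G p‖ ≤ M') : StripRegularC G κ M' :=
  stripRegularC_of_polyHol_of_le (polyHol_of_polyRegular h) hκ hM

end Scalar

section Matrix

variable {n : Type*} {A A' B C D : (Fin (d + 1) → ℂ) → Matrix n n ℂ} {w w' : Fin (d + 1) → ℝ}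

/-- `MatPolyHol` restricts to smaller half-widths. [folklore] -/
theorem matPolyHol_of_le (hA : MatPolyHol A w) (hw : ∀ j, w' j ≤ w j) : MatPolyHol A w' :=
  fun i j => polyHol_of_le (hA i j) hw

/-! ## §2 Two-width consumer forms -/

/-- THE ONE-LOOP FORM AT TWO WIDTHS: `MatPolyHol` data and `det ≠ 0` ((Z1)) certified on the strip of half-width `a ≥ 0`,
a certified bound `M` on the narrower `Strip κ` (`0 ≤ κ ≤ a`) ⇒ `StripRegularC (tr(A⁻¹B) − tr(A⁻¹ C A′⁻¹ D)) κ M`. [folklore] -/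
theorem stripRegularC_oneLoopForm₂ [Fintype n] [DecidableEq n] {a κ M : ℝ} (hκ : 0 ≤ κ) (hκa : κ ≤ a)
    (hA : MatPolyHol A (fun _ => a)) (hA' : MatPolyHol A' (fun _ => a)) (hBst : MatPolyHol B (fun _ => a))
    (hBs : MatPolyHol C (fun _ => a)) (hBt : MatPolyHol D (fun _ => a))
    (hdet : ∀ p ∈ Strip (d + 1) a, (A p).det ≠ 0) (hdet' : ∀ p ∈ Strip (d + 1) a, (A' p).det ≠ 0)
    (hM : ∀ p ∈ Strip (d + 1) κ, ‖((A p)⁻¹ * B p).trace - ((A p)⁻¹ * C p * (A' p)⁻¹ * D p).trace‖ ≤ M) :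
    StripRegularC (fun p => ((A p)⁻¹ * B p).trace - ((A p)⁻¹ * C p * (A' p)⁻¹ * D p).trace) κ M :=
  have hw : ∀ _j : Fin (d + 1), κ ≤ a := fun _ => hκa
  stripRegularC_oneLoopForm hκ (matPolyHol_of_le hA hw) (matPolyHol_of_le hA' hw) (matPolyHol_of_le hBst hw)
    (matPolyHol_of_le hBs hw) (matPolyHol_of_le hBt hw)
    (fun p hp => hdet p (strip_mono (d + 1) hκa hp)) (fun p hp => hdet' p (strip_mono (d + 1) hκa hp)) hM

/-- THE JET FUNCTIONAL AT TWO WIDTHS: `PolyHol (jetFunctional f)` at half-width `a`, the mixed-Cauchy data with a uniform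
certified `C` on `Strip κ × closedBall r × sphere r`, `κ ≤ a` ⇒ `StripRegularC (jetFunctional f) κ (C/(2r²))`. [folklore] -/
theorem stripRegularC_jet_of_bound₂ {f : (Fin (d + 1) → ℂ) → ℂ → ℂ → ℂ} {a κ r C : ℝ} (hr : 0 < r) (hκa : κ ≤ a)
    (hG : PolyHol (jetFunctional f) (fun _ => a))
    (h₂ : ∀ q ∈ Strip (d + 1) κ, ∀ p₁ ∈ closedBall (0 : ℂ) r, DiffContOnCl ℂ (f q p₁) (ball 0 r))
    (hC : ∀ q ∈ Strip (d + 1) κ, ∀ p₁ ∈ closedBall (0 : ℂ) r, ∀ p₂ ∈ sphere (0 : ℂ) r, ‖f q p₁ p₂‖ ≤ C)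
    (h₁ : ∀ q ∈ Strip (d + 1) κ, DiffContOnCl ℂ (fun p₁ => deriv (f q p₁) 0) (ball 0 r)) :
    StripRegularC (jetFunctional f) κ (C / (2 * r ^ 2)) :=
  stripRegularC_jet_of_bound hr (polyHol_of_le hG fun _ => hκa) h₂ hC h₁

end Matrix

end

end Summit.QuantumFields.BalabanUV.Beta.PolyRegularRestrict
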